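import Summits.QuantumFields.YangMills.Theorems.BalabanUVNodesN15CovariantLaplacianSpecies
import HarnessLib

/-!
# Route «BalabanUVNodes» (cluster K4 «SpineRates»), Track-A DAG node N15 = NE2, BACKGROUND LAYER — (3.53) AROUND A CURVED BACKGROUND, TRANSPORTER FORM:
# `Δ_{SR} = Δ_R − V_R(c, a)` with the BACKGROUND's OWN covariant derivatives as the derived pieces, the orthogonality cancellation in the zeroth-order
# coefficient, and the row letters of the exact coefficients from transporter-form (3.37)-shaped letters (the curved twin of dag-n15-c FILE 28)

Cell `pub-ymgap`, seat `pub-ymgap-dag-n15-w3` (WIDTH SEAT 3∕3 on node N15, director-ym №197 ∕ HUMAN RULING D-0149; plan g77 `W-SEAT-START-LIST.md` §n15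
item 3 «the LG-vector + background layers at GENERAL small-field U … start with the operator-layer letter at curved U» — this file is that first piece).
`bears_on: R4∕N15 · K3⁷ SpineGivenEndpointR13SepCoPH (stmt-QuantumFields-20544)`.  Filed `--kind proof --supports stmt-QuantumFields-20544 --as helper` —
COUNT-NEUTRAL.  Imports BY NAME dag-n15-c FILE 28 `…N15CovariantLaplacianSpecies` (p581666: `covLapM`, `covLapM_apply`, `speciesOpM`, `tCoefA`, `tCoefC`, `covD_one`,
`fdiffN_liftMap_eq_fgrad`, `fdiffN_liftMap_symm_eq_neg_bgrad`; through it n15-b part 18 `covD`, `covD_apply`, part 14 `mmulOp`, FILE 1 `fgrad`∕`bgrad`); nothing in the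
tree is modified; the flat identity (3.53) itself (`covLapM_eq_one_sub_speciesOpM`) is CONSUMED, not re-derived.

WHY.  FILE 28 types Bałaban's covariant Laplacian (3.50) `covLapM τ η R` for ARBITRARY bond transports and (3.53) `Δ_R = Δ_1 − V(c, a)` — the exact species AROUND THE
FLAT BACKGROUND, whose derived pieces are the plain quotients `∇^±_μ`; every background-layer file of the lineage carries the caveat *«shapes of (3.52) in the `U ≡ 1`
background — the print's `D^η_U` carries parallel transports `R(U_b)`, here `U ≡ 1`»*.  [Balaban1985BackgroundPropagators] (3.52)–(3.53) p. 400 expand the PERTURBED operator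
`Δ_{U′U}` around a CURVED background `U`: *«(V′₁(A)λ)(x) = Σ_{b∈st(x)} i[A′(b), (D^η_U λ)(b)] + i[(D^{η*}_U A′)(x), λ(x)] + Σ_{b∈st(x)} F′_{1,k}(i ad_{A′(b)}) λ(b₊)»*,
*«Δ_{U′U} = Δ_U − V′₁(A)»* — first order in the BACKGROUND's covariant derivatives `D^η_U`, zeroth order through the COVARIANT divergence `D^{η*}_U A′`, plus the
exponential remainder.  THIS FILE types that structure EXACTLY, in TRANSPORTER FORM (no `ad`, no `exp`, no coordinates): the background enters through ONE forward transporter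
field `R_μ(x)` in a real ORTHOGONAL representation, read as a lattice gauge field (`gaugePair`: the backward transporter on `(x, x − e_μ)` is `R_μ(x − e_μ)ᵀ = R(U_b)⁻¹`,
the print's `U(b̄) = U(b)⁻¹`), the perturbation through its forward transporters `S_μ(x)` (`R(U′_bU_b) = S_μ(x)R_μ(x)`):

* (i) ★★ `covLapM_gaugePair_mul_eq`: `Δ_{SR} = Δ_R − V_R(c, a)` EXACTLY (all orders, non-abelian) for `R_μ(x)R_μ(x)ᵀ = 1`, where `V_R(c, a) = M_c + Σ_μ[M_{a⁺_μ}∘D⁺_{R,μ} +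
  M_{a⁻_μ}∘D⁻_{R,μ}]` (`covSpeciesOpM`) has the BACKGROUND's covariant derivatives as pieces (`D⁺_{R,μ} = covD η R_μ τ_μ`, `D⁻_{R,μ} = −covD η R₋ᵀ τ_μ⁻¹`, `R₋ = R_μ(· − e_μ)`;
  at `R ≡ 1` these are FILE 1's `∇⁺_μ`, `∇⁻_μ` and `V_1 = speciesOpM`: `covSpeciesOpM_one`), with `a⁺_μ = η⁻¹(S_μ − 1)`, `a⁻_μ = η⁻¹·R₋ᵀ(1 − S₋ᵀ)R₋`,
  `c = η⁻¹Σ_μ(a⁺_μ − a⁻_μ)` (`curvCoefA`, `curvCoefC` — FILE 28's `tCoefA`∕`tCoefC` format; at `R ≡ 1` they ARE `tCoefA`∕`tCoefC` of `gaugePair τ S`: `curvCoefA_one`, `curvCoefC_one`);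
* (ii) ★ `curvCoefC_eq_cancel` — THE ORTHOGONALITY CANCELLATION: for orthogonal `S`, `R`, `c = −η⁻²Σ_μ[(1 − S_μ)(1 − S_μ)ᵀ + (S_μ − R₋ᵀS₋R₋)ᵀ]`: SECOND order in `1 − S` plus the
  transposed COVARIANT backward difference `S_μ(x) − Ad_{R₋ᵀ}S_μ(x − e_μ)` of the perturbation's transporter field (the `i[(D^{η*}_U A′)(x), ·] + F′` structure of (3.52)) — what
  makes the zeroth-order coefficient `(L^jη)^{−2}`-small at a CURVED background although `η⁻²(1 − S)` alone is only `(η·L^jη)^{−1}`-small;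
* (iii) ROW LETTERS (§4) from transporter-form (3.37)-shaped letters `|S_μ(x) − 1| ≤ ηp` (field), `|S_μ(x) − R₋ᵀS₋R₋| ≤ η²q` (covariant gradient), entrywise: rows of
  `a⁺ ≤ |ι|p`, `a⁻ ≤ |ι|³p`, `c ≤ |J|·|ι|(|ι|p² + q)`; the (3.42)-prefactor reading at `p = α₁∕ℓ`, `q = α₁∕ℓ²`, `ℓ = L^jη` (`rowSum_curv_pref`): after `|J|, |ι|, α₁` ONLY.

HONEST FRAMING ∕ LIMITS.  ALGEBRA + crude letters over FREE transporter data ([B9] (3.50)–(3.53) p. 400, (3.35)–(3.37) p. 396, (3.42) p. 397 are SHAPES only;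
nothing of [B9] asserted).  At a CURVED `R` the consumer with covariant derived pieces (the Neumann series (3.63)–(3.65) of `G(U′U)` around `G(U)`, the analyticity ∕ NE2-LIP
direction) is NOT in the tree; at `R ≡ 1` the consumer is FILE 24's socket via FILE 28.  The transporter-form letters are hypotheses (their discharge from `S = exp(η ad A′)` is
dag-n15-b 13a∕13b's `exp`∕`ad` letters).  NE2⁺ NOT PRINTED, NOT proved; N15 NOT discharged; counts of record UNMOVED (typed 28∕28 · discharged 5∕27); one finite 𝕋⁴ at fixed ε
— NOT infinite volume, NOT OS on ℝ⁴, NOT a mass gap, NOT Clay; R4 closes the conditional finite-𝕋⁴ rung `BalabanLadder.UV` only.  Restate-immune (no Theses import).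
-/

set_option autoImplicit false

noncomputable section
open scoped BigOperators Matrix
open Finset

namespace Summit.QuantumFields.YangMills.BalabanUVNodes.N15.CurvedSpecies

open Literature.MathematicalPhysics.QuantumFieldTheory.Balaban1983to89.T4EtaRateCoeffDefect (pull pull_apply)
open Summit.QuantumFields.YangMills.BalabanUVNodes.N15.DerivDefect (fdiffN fdiffN_apply)
open Summit.QuantumFields.YangMills.BalabanUVNodes.N15.MatrixSpecies (mmulOp mmulOp_apply liftMap liftEquiv covD covD_apply)
open Summit.QuantumFields.YangMills.BalabanUVNodes.N15.BackgroundLayer (fgrad bgrad speciesOpM covLapM covLapM_apply tCoefA tCoefC tCoefA_inl tCoefA_inr covD_one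
  fdiffN_liftMap_eq_fgrad fdiffN_liftMap_symm_eq_neg_bgrad)

variable {X ι J : Type} [Fintype ι] [DecidableEq ι] [Fintype J]

/-! ## §1 The gauge-field reading of one forward transporter field; the species operator with covariant pieces -/

section Pieces

variable (η : ℝ) (τ : J → X ≃ X)

/-- THE LATTICE-GAUGE-FIELD READING of ONE forward transporter field `R_μ(x)` (an orthogonal representative of `U(x, x + e_μ)`) as FILE 28's two-sided transport
datum: forward bond `(x, x + e_μ) ↦ R_μ(x)`, backward bond `(x, x − e_μ) ↦ R_μ(x − e_μ)ᵀ` — the print's `U(b̄) = U(b)⁻¹` for an orthogonal representation.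
[cite: Balaban1985BackgroundPropagators, (3.50) p.400] -/
def gaugePair (R : J → X → Matrix ι ι ℝ) : J ⊕ J → X → Matrix ι ι ℝ :=
  Sum.elim R (fun μ x => (R μ ((τ μ).symm x))ᵀ)

omit [Fintype ι] [DecidableEq ι] [Fintype J] in
/-- Unfolding (forward). [folklore] -/
@[simp] theorem gaugePair_inl (R : J → X → Matrix ι ι ℝ) (μ : J) (x : X) : gaugePair τ R (Sum.inl μ) x = R μ x := rfl

omit [Fintype ι] [DecidableEq ι] [Fintype J] in
/-- Unfolding (backward). [folklore] -/
@[simp] theorem gaugePair_inr (R : J → X → Matrix ι ι ℝ) (μ : J) (x : X) : gaugePair τ R (Sum.inr μ) x = (R μ ((τ μ).symm x))ᵀ := rfl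

omit [Fintype ι] [Fintype J] in
/-- The trivial field reads as the trivial transport datum. [folklore] -/
theorem gaugePair_one : gaugePair τ (fun (_ : J) (_ : X) => (1 : Matrix ι ι ℝ)) = fun _ _ => 1 := by
  funext j x
  cases j with
  | inl μ => rfl
  | inr μ => exact Matrix.transpose_one

/-- THE TWO-SIDED SPECIES OPERATOR WITH THE BACKGROUND's COVARIANT DERIVATIVES AS PIECES: `V_R(C, A) = M_C + Σ_μ[M_{A⁺_μ}∘D⁺_{R,μ} + M_{A⁻_μ}∘D⁻_{R,μ}]`,
`D⁺_{R,μ} = covD η R⁺_μ τ_μ` (n15-b), `D⁻_{R,μ} = −covD η R⁻_μ τ_μ⁻¹` (the lineage's backward-quotient sign, `bgrad` at `R ≡ 1`) — the shape of (3.52) around a CURVED `U`.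
[cite: Balaban1985BackgroundPropagators, (3.52) p.400 (shape)] -/
def covSpeciesOpM (R : J ⊕ J → X → Matrix ι ι ℝ) (C : X → Matrix ι ι ℝ) (A : J ⊕ J → X → Matrix ι ι ℝ) : (X × ι → ℝ) →ₗ[ℝ] (X × ι → ℝ) :=
  mmulOp C + ∑ μ, (mmulOp (A (Sum.inl μ)) ∘ₗ covD η (R (Sum.inl μ)) (τ μ) - mmulOp (A (Sum.inr μ)) ∘ₗ covD η (R (Sum.inr μ)) (τ μ).symm)

/-- DICTIONARY (flat background): at `R ≡ 1` the covariant pieces are FILE 1's quotients and `V_1(C, A)` IS FILE 28's `speciesOpM τ η⁻¹ C A`. [folklore] -/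
theorem covSpeciesOpM_one (C : X → Matrix ι ι ℝ) (A : J ⊕ J → X → Matrix ι ι ℝ) :
    covSpeciesOpM η τ (fun _ _ => 1) C A = speciesOpM τ η⁻¹ C A := by
  unfold covSpeciesOpM speciesOpM
  congr 1
  refine Finset.sum_congr rfl fun μ _ => ?_
  rw [show (fun _ : X => (1 : Matrix ι ι ℝ)) = fun _ => 1 from rfl, covD_one, covD_one, fdiffN_liftMap_eq_fgrad, fdiffN_liftMap_symm_eq_neg_bgrad,
    LinearMap.comp_neg, sub_neg_eq_add]

end Pieces

/-! ## §2 The exact coefficients and the identity (3.53) around a curved orthogonal background -/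

section Species

/-- The fibre vector of a field at a lattice point: `vecAt f x = (f(x, j))_j`. [folklore] -/
def vecAt (f : X × ι → ℝ) (x : X) : ι → ℝ := fun j => f (x, j)

omit [DecidableEq ι] in
/-- The matrix multiplication operator is the fibrewise matrix–vector product. [folklore] -/
theorem mmulOp_apply_mulVec (C : X → Matrix ι ι ℝ) (f : X × ι → ℝ) (p : X × ι) :
    mmulOp C f p = (C p.1 *ᵥ vecAt f p.1) p.2 := rfl

/-- The covariant derivative, fibrewise: `(D_{R,s} f)(x, ·) = η⁻¹·(R(x)·f(sx, ·) − f(x, ·))`. [folklore] -/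
theorem vecAt_covD (η : ℝ) (R : X → Matrix ι ι ℝ) (s : X → X) (f : X × ι → ℝ) (x : X) :
    vecAt (covD η R s f) x = η⁻¹ • (R x *ᵥ vecAt f (s x) - vecAt f x) := by
  funext i
  simp only [vecAt, covD_apply, Pi.smul_apply, Pi.sub_apply, smul_eq_mul, Matrix.mulVec, dotProduct]

variable (η : ℝ) (τ : J → X ≃ X) (R S : J → X → Matrix ι ι ℝ)

/-- THE TRANSPORTED BACKWARD DEFECT of the perturbation's transporter field: `conjDef τ R S μ x = R₋ᵀ(1 − S₋ᵀ)R₋`, `R₋ = R_μ(x − e_μ)`, `S₋ = S_μ(x − e_μ)` (for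
orthogonal `R`: `1 − (R₋ᵀS₋R₋)ᵀ`, §3). [folklore] -/
def conjDef (μ : J) (x : X) : Matrix ι ι ℝ :=
  (R μ ((τ μ).symm x))ᵀ * (1 - (S μ ((τ μ).symm x))ᵀ) * R μ ((τ μ).symm x)

/-- THE EXACT FIRST-ORDER COEFFICIENTS around the curved background, FILE 28's `tCoefA` format: `a⁺_μ = η⁻¹(S_μ − 1)` (`inl`, on `D⁺_{R,μ}`),
`a⁻_μ = η⁻¹·R₋ᵀ(1 − S₋ᵀ)R₋` (`inr`, on `D⁻_{R,μ}`). [cite: Balaban1985BackgroundPropagators, (3.51)–(3.52) p.400 (shape)] -/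
def curvCoefA : J ⊕ J → X → Matrix ι ι ℝ :=
  Sum.elim (fun μ x => η⁻¹ • (S μ x - 1)) (fun μ x => η⁻¹ • conjDef τ R S μ x)

/-- THE EXACT ZEROTH-ORDER COEFFICIENT around the curved background, FILE 28's `tCoefC` format: `c = η⁻¹Σ_μ(a⁺_μ − a⁻_μ)`.
[cite: Balaban1985BackgroundPropagators, (3.51)–(3.52) p.400 (shape)] -/
def curvCoefC : X → Matrix ι ι ℝ :=
  fun x => η⁻¹ • ∑ μ, (curvCoefA η τ R S (Sum.inl μ) x - curvCoefA η τ R S (Sum.inr μ) x)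

omit [Fintype J] in
/-- Unfolding (forward). [folklore] -/
@[simp] theorem curvCoefA_inl (μ : J) (x : X) : curvCoefA η τ R S (Sum.inl μ) x = η⁻¹ • (S μ x - 1) := rfl

omit [Fintype J] in
/-- Unfolding (backward). [folklore] -/
@[simp] theorem curvCoefA_inr (μ : J) (x : X) : curvCoefA η τ R S (Sum.inr μ) x = η⁻¹ • conjDef τ R S μ x := rfl

omit [Fintype J] in
/-- DICTIONARY (flat background): at `R ≡ 1` the curved first-order coefficients ARE FILE 28's exact transport coefficients of the perturbation read as a gauge field,
`curvCoefA η τ 1 S = tCoefA η (gaugePair τ S)`. [folklore] -/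
theorem curvCoefA_one : curvCoefA η τ (fun _ _ => 1) S = tCoefA η (gaugePair τ S) := by
  funext j x
  cases j with
  | inl μ => rw [curvCoefA_inl, tCoefA_inl, gaugePair_inl]
  | inr μ => rw [curvCoefA_inr, tCoefA_inr, gaugePair_inr, conjDef, Matrix.transpose_one, Matrix.one_mul, Matrix.mul_one]

/-- DICTIONARY (flat background): `curvCoefC η τ 1 S = tCoefC η (gaugePair τ S)`. [folklore] -/
theorem curvCoefC_one : curvCoefC η τ (fun _ _ => 1) S = tCoefC η (gaugePair τ S) := by
  funext x
  simp only [curvCoefC, tCoefC, curvCoefA_one]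

omit [Fintype J] in
/-- THE VECTOR IDENTITY behind the species (one direction, one point), `B = R₋ᵀ(1 − S₋ᵀ)R₋`, `R₋R₋ᵀ = 1`: `((S − 1) − B)v₀ + (S − 1)(Rv₊ − v₀) − B(R₋ᵀv₋ − v₀) = SRv₊ − Rv₊ + (S₋R₋)ᵀv₋ − R₋ᵀv₋`. [folklore] -/
theorem key_mulVec (R₀ Rm S₀ Sm : Matrix ι ι ℝ) (hR : Rm * Rmᵀ = 1) (v₀ vp vm : ι → ℝ) :
    ((S₀ - 1) - Rmᵀ * (1 - Smᵀ) * Rm) *ᵥ v₀ + (S₀ - 1) *ᵥ (R₀ *ᵥ vp - v₀) - (Rmᵀ * (1 - Smᵀ) * Rm) *ᵥ (Rmᵀ *ᵥ vm - v₀) =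
      (S₀ * R₀) *ᵥ vp - R₀ *ᵥ vp + (Sm * Rm)ᵀ *ᵥ vm - Rmᵀ *ᵥ vm := by
  have hB : Rmᵀ * (1 - Smᵀ) * Rm * Rmᵀ = Rmᵀ - (Sm * Rm)ᵀ := by
    rw [Matrix.mul_assoc, hR, Matrix.mul_one, Matrix.mul_sub, Matrix.mul_one, Matrix.transpose_mul]
  rw [Matrix.mulVec_sub (Rmᵀ * (1 - Smᵀ) * Rm), Matrix.mulVec_mulVec, hB, Matrix.mulVec_sub (S₀ - 1), Matrix.mulVec_mulVec,
    Matrix.sub_mulVec, Matrix.sub_mulVec, Matrix.sub_mulVec, Matrix.one_mulVec, Matrix.sub_mul, Matrix.one_mul, Matrix.sub_mulVec]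
  abel

/-- ★★ **(3.53) AROUND A CURVED ORTHOGONAL BACKGROUND, TRANSPORTER FORM, pointwise.**  For a forward transporter field `R` with `R_μ(x)R_μ(x)ᵀ = 1` and a perturbation
transporter field `S` (perturbed transporters `S_μ(x)R_μ(x)`): `Δ_{SR} f = Δ_R f − V_R(c, a) f` at every point, the pieces of `V_R` being the BACKGROUND's covariant
derivatives — EXACT, all orders, non-abelian. [cite: Balaban1985BackgroundPropagators, (3.50)–(3.53) p.400 (shape, mechanism)] -/
theorem covLapM_gaugePair_mul_apply (hR : ∀ μ x, R μ x * (R μ x)ᵀ = 1) (f : X × ι → ℝ) (p : X × ι) :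
    covLapM τ η (gaugePair τ (fun μ x => S μ x * R μ x)) f p =
      covLapM τ η (gaugePair τ R) f p - covSpeciesOpM η τ (gaugePair τ R) (curvCoefC η τ R S) (curvCoefA η τ R S) f p := by
  obtain ⟨x, i⟩ := p
  rw [eq_sub_iff_add_eq]
  -- the two Laplacians, fibrewise
  have hLap : ∀ T : J → X → Matrix ι ι ℝ, covLapM τ η (gaugePair τ T) f (x, i) =
      η⁻¹ * η⁻¹ * ∑ μ, ((f (x, i) - (T μ x *ᵥ vecAt f (τ μ x)) i) + (f (x, i) - ((T μ ((τ μ).symm x))ᵀ *ᵥ vecAt f ((τ μ).symm x)) i)) := by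
    intro T
    rw [covLapM_apply]
    rfl
  -- the species term, fibrewise
  have hV : covSpeciesOpM η τ (gaugePair τ R) (curvCoefC η τ R S) (curvCoefA η τ R S) f (x, i) =
      ∑ μ, (η⁻¹ * η⁻¹ * ((((S μ x - 1) - conjDef τ R S μ x) *ᵥ vecAt f x) i) +
        η⁻¹ * η⁻¹ * (((S μ x - 1) *ᵥ (R μ x *ᵥ vecAt f (τ μ x) - vecAt f x)) i -
          (conjDef τ R S μ x *ᵥ ((R μ ((τ μ).symm x))ᵀ *ᵥ vecAt f ((τ μ).symm x) - vecAt f x)) i)) := by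
    have hC : mmulOp (curvCoefC η τ R S) f (x, i) = ∑ μ, η⁻¹ * η⁻¹ * ((((S μ x - 1) - conjDef τ R S μ x) *ᵥ vecAt f x) i) := by
      rw [mmulOp_apply_mulVec, curvCoefC, Matrix.smul_mulVec, Pi.smul_apply, smul_eq_mul, Matrix.sum_mulVec, Finset.sum_apply, Finset.mul_sum]
      refine Finset.sum_congr rfl fun μ _ => ?_
      rw [curvCoefA_inl, curvCoefA_inr, ← smul_sub, Matrix.smul_mulVec, Pi.smul_apply, smul_eq_mul, mul_assoc]
    have hS : (∑ μ, (mmulOp (curvCoefA η τ R S (Sum.inl μ)) ∘ₗ covD η (gaugePair τ R (Sum.inl μ)) (τ μ) -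
        mmulOp (curvCoefA η τ R S (Sum.inr μ)) ∘ₗ covD η (gaugePair τ R (Sum.inr μ)) (τ μ).symm)) f (x, i) =
        ∑ μ, η⁻¹ * η⁻¹ * (((S μ x - 1) *ᵥ (R μ x *ᵥ vecAt f (τ μ x) - vecAt f x)) i -
          (conjDef τ R S μ x *ᵥ ((R μ ((τ μ).symm x))ᵀ *ᵥ vecAt f ((τ μ).symm x) - vecAt f x)) i) := by
      rw [LinearMap.coe_sum, Finset.sum_apply, Finset.sum_apply]
      refine Finset.sum_congr rfl fun μ _ => ?_
      rw [LinearMap.sub_apply, Pi.sub_apply, LinearMap.comp_apply, LinearMap.comp_apply, mmulOp_apply_mulVec, mmulOp_apply_mulVec, vecAt_covD, vecAt_covD,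
        gaugePair_inl, gaugePair_inr, curvCoefA_inl, curvCoefA_inr, Matrix.smul_mulVec, Matrix.smul_mulVec, Matrix.mulVec_smul, Matrix.mulVec_smul]
      simp only [Pi.smul_apply, smul_eq_mul]
      ring
    rw [covSpeciesOpM, LinearMap.add_apply, Pi.add_apply, hC, hS, ← Finset.sum_add_distrib]
  rw [hLap, hLap, hV, Finset.mul_sum, Finset.mul_sum, ← Finset.sum_add_distrib]
  refine Finset.sum_congr rfl fun μ _ => ?_
  have hk := congrFun (key_mulVec (R μ x) (R μ ((τ μ).symm x)) (S μ x) (S μ ((τ μ).symm x)) (hR μ _) (vecAt f x) (vecAt f (τ μ x))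
    (vecAt f ((τ μ).symm x))) i
  simp only [conjDef, Pi.add_apply, Pi.sub_apply, Matrix.transpose_mul] at hk ⊢
  linear_combination (η⁻¹ * η⁻¹) * hk

/-- ★★ **(3.53) AROUND A CURVED ORTHOGONAL BACKGROUND, as operators**: `Δ_{SR} = Δ_R − V_R(c, a)` for every orthogonal forward transporter field `R` (`R_μ(x)R_μ(x)ᵀ = 1`)
and every perturbation transporter field `S`; at `R ≡ 1` this is FILE 28's `covLapM_eq_one_sub_speciesOpM` at the transport `gaugePair τ S` (`covSpeciesOpM_one`,
`curvCoefA_one`, `curvCoefC_one`, `gaugePair_one`). [cite: Balaban1985BackgroundPropagators, (3.50)–(3.53) p.400 (shape, mechanism)] -/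
theorem covLapM_gaugePair_mul_eq (hR : ∀ μ x, R μ x * (R μ x)ᵀ = 1) :
    covLapM τ η (gaugePair τ (fun μ x => S μ x * R μ x)) =
      covLapM τ η (gaugePair τ R) - covSpeciesOpM η τ (gaugePair τ R) (curvCoefC η τ R S) (curvCoefA η τ R S) :=
  LinearMap.ext fun f => funext fun p => by rw [LinearMap.sub_apply, Pi.sub_apply]; exact covLapM_gaugePair_mul_apply η τ R S hR f p

end Species

/-! ## §3 The orthogonality cancellation in the zeroth-order coefficient -/

section Cancel

variable (τ : J → X ≃ X) (R S : J → X → Matrix ι ι ℝ)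

/-- `η`·(THE COVARIANT BACKWARD DIFFERENCE of the perturbation's transporter field): `S_μ(x) − R₋ᵀS_μ(x − e_μ)R₋` — the transporter at `x` minus the transporter
at `x − e_μ` PARALLEL-TRANSPORTED to `x` by the background (the print's `(D^{η*}_U A′)(x)` structure). [cite: Balaban1985BackgroundPropagators, (3.52) p.400 (shape)] -/
def covShiftDefect (μ : J) (x : X) : Matrix ι ι ℝ :=
  S μ x - (R μ ((τ μ).symm x))ᵀ * S μ ((τ μ).symm x) * R μ ((τ μ).symm x)

omit [Fintype J] in
/-- For an orthogonal background (`R₋ᵀR₋ = 1`) the transported backward defect is `1 − (R₋ᵀS₋R₋)ᵀ`. [folklore] -/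
theorem conjDef_eq_one_sub (hR : ∀ μ x, (R μ x)ᵀ * R μ x = 1) (μ : J) (x : X) :
    conjDef τ R S μ x = 1 - ((R μ ((τ μ).symm x))ᵀ * S μ ((τ μ).symm x) * R μ ((τ μ).symm x))ᵀ := by
  rw [conjDef, Matrix.mul_sub, Matrix.mul_one, Matrix.sub_mul, hR, Matrix.transpose_mul, Matrix.transpose_mul,
    Matrix.transpose_transpose, Matrix.mul_assoc]

omit [Fintype J] in
/-- For an orthogonal perturbation (`SSᵀ = 1`): `(1 − S)(1 − S)ᵀ = (1 − S) + (1 − Sᵀ)`. [folklore] -/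
theorem one_sub_mul_one_sub_transpose {S₀ : Matrix ι ι ℝ} (hS : S₀ * S₀ᵀ = 1) :
    (1 - S₀) * (1 - S₀)ᵀ = (1 - S₀) + (1 - S₀ᵀ) := by
  rw [Matrix.transpose_sub, Matrix.transpose_one, Matrix.sub_mul, Matrix.one_mul, Matrix.mul_sub, Matrix.mul_one, hS]
  abel

/-- ★ **THE ORTHOGONALITY CANCELLATION.**  For orthogonal `S` (`S_μ(x)S_μ(x)ᵀ = 1`) and `R` (`R_μ(x)ᵀR_μ(x) = 1`) the zeroth-order coefficient is
`c = −η⁻²Σ_μ[(1 − S_μ)(1 − S_μ)ᵀ + (S_μ − R₋ᵀS₋R₋)ᵀ]`: SECOND ORDER in `1 − S` plus the TRANSPOSED COVARIANT BACKWARD DIFFERENCE of `S` — the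
`i[(D^{η*}_U A′)(x), ·] + F′_{1,k}` structure of (3.52), which makes `c` `(L^jη)^{−2}`-small under (3.37)-shaped letters (§4).
[cite: Balaban1985BackgroundPropagators, (3.52) p.400 (shape, mechanism)] -/
theorem curvCoefC_eq_cancel (η : ℝ) (hS : ∀ μ x, S μ x * (S μ x)ᵀ = 1) (hR : ∀ μ x, (R μ x)ᵀ * R μ x = 1) (x : X) :
    curvCoefC η τ R S x = -((η⁻¹ * η⁻¹) • ∑ μ, ((1 - S μ x) * (1 - S μ x)ᵀ + (covShiftDefect τ R S μ x)ᵀ)) := by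
  have hμ : ∀ μ, curvCoefA η τ R S (Sum.inl μ) x - curvCoefA η τ R S (Sum.inr μ) x =
      -(η⁻¹ • ((1 - S μ x) * (1 - S μ x)ᵀ + (covShiftDefect τ R S μ x)ᵀ)) := fun μ => by
    rw [curvCoefA_inl, curvCoefA_inr, ← smul_sub, ← smul_neg, one_sub_mul_one_sub_transpose (hS μ x), conjDef_eq_one_sub τ R S hR, covShiftDefect,
      Matrix.transpose_sub]
    congr 1
    abel
  rw [curvCoefC, Finset.sum_congr rfl fun μ _ => hμ μ, Finset.sum_neg_distrib, smul_neg, ← Finset.smul_sum, smul_smul]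

end Cancel

/-! ## §4 Row letters of the exact coefficients from transporter-form (3.37)-shaped letters -/

section Letters

variable (τ : J → X ≃ X) (R S : J → X → Matrix ι ι ℝ)

/-- Entries of an orthogonal matrix are bounded by one: `RRᵀ = 1 ⟹ |R_{ij}| ≤ 1` (the `i`-th row is a unit vector). [folklore] -/
theorem abs_entry_le_one_of_orthogonal {R₀ : Matrix ι ι ℝ} (hR : R₀ * R₀ᵀ = 1) (i j : ι) : |R₀ i j| ≤ 1 := by
  have hrow : ∑ k, R₀ i k * R₀ i k = 1 := by
    have := congrFun (congrFun hR i) i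
    simpa [Matrix.mul_apply, Matrix.transpose_apply, Matrix.one_apply] using this
  have hle : R₀ i j * R₀ i j ≤ 1 := by
    rw [← hrow]
    exact Finset.single_le_sum (f := fun k => R₀ i k * R₀ i k) (fun k _ => mul_self_nonneg (R₀ i k)) (Finset.mem_univ j)
  exact abs_le_one_iff_mul_self_le_one.mpr hle

omit [Fintype J] in
/-- ENTRY LETTER of the transported backward defect: `|(R₋ᵀ(1 − S₋ᵀ)R₋)_{ij}| ≤ |ι|²·ηp` from `|S − 1| ≤ ηp` entrywise and `|R_{kl}| ≤ 1`. [folklore] -/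
theorem abs_conjDef_entry_le {η p : ℝ} (hR1 : ∀ μ x i j, |R μ x i j| ≤ 1) (hS : ∀ μ x i j, |(S μ x - 1) i j| ≤ η * p) (μ : J) (x : X) (i j : ι) :
    |conjDef τ R S μ x i j| ≤ (Fintype.card ι : ℝ) ^ 2 * (η * p) := by
  set y := (τ μ).symm x with hy
  have hent : ∀ k l, |(R μ y)ᵀ i k * (1 - (S μ y)ᵀ) k l * R μ y l j| ≤ η * p := fun k l => by
    rw [abs_mul, abs_mul, Matrix.transpose_apply]
    have h1 := hR1 μ y k i
    have h3 := hR1 μ y l j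
    have h2 : |(1 - (S μ y)ᵀ) k l| ≤ η * p := by
      have : (1 - (S μ y)ᵀ) k l = -((S μ y - 1) l k) := by
        simp only [Matrix.sub_apply, Matrix.one_apply, Matrix.transpose_apply, neg_sub, eq_comm]
      rw [this, abs_neg]
      exact hS μ y l k
    have hp : 0 ≤ η * p := (abs_nonneg _).trans h2
    calc |R μ y k i| * |(1 - (S μ y)ᵀ) k l| * |R μ y l j| ≤ 1 * (η * p) * 1 := by gcongr
      _ = η * p := by ring
  calc |conjDef τ R S μ x i j| = |∑ l, (∑ k, (R μ y)ᵀ i k * (1 - (S μ y)ᵀ) k l) * R μ y l j| := by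
        rw [conjDef, ← hy, Matrix.mul_apply]; rfl
    _ ≤ ∑ l, ∑ k, |(R μ y)ᵀ i k * (1 - (S μ y)ᵀ) k l * R μ y l j| := by
        refine (Finset.abs_sum_le_sum_abs _ _).trans (Finset.sum_le_sum fun l _ => ?_)
        rw [Finset.sum_mul]; exact Finset.abs_sum_le_sum_abs _ _
    _ ≤ ∑ _l : ι, ∑ _k : ι, η * p := Finset.sum_le_sum fun l _ => Finset.sum_le_sum fun k _ => hent k l
    _ = (Fintype.card ι : ℝ) ^ 2 * (η * p) := by
        rw [Finset.sum_const, Finset.sum_const, Finset.card_univ, nsmul_eq_mul, nsmul_eq_mul]; ring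

omit [Fintype J] in
/-- ROW LETTER of the forward coefficient: `Σ_j|a⁺_μ(x)_{ij}| ≤ |ι|·p` from `|S_μ(x) − 1| ≤ ηp` entrywise (`η > 0`). [folklore] -/
theorem rowSum_curvCoefA_inl_le {η p : ℝ} (hη : 0 < η) (hS : ∀ μ x i j, |(S μ x - 1) i j| ≤ η * p) (μ : J) (x : X) (i : ι) :
    ∑ j, |curvCoefA η τ R S (Sum.inl μ) x i j| ≤ (Fintype.card ι : ℝ) * p := by
  have hent : ∀ j, |curvCoefA η τ R S (Sum.inl μ) x i j| ≤ p := fun j => by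
    rw [curvCoefA_inl, Matrix.smul_apply, smul_eq_mul, abs_mul, abs_of_pos (inv_pos.mpr hη)]
    calc η⁻¹ * |(S μ x - 1) i j| ≤ η⁻¹ * (η * p) := mul_le_mul_of_nonneg_left (hS μ x i j) (inv_pos.mpr hη).le
      _ = p := by field_simp
  calc ∑ j, |curvCoefA η τ R S (Sum.inl μ) x i j| ≤ ∑ _j : ι, p := Finset.sum_le_sum fun j _ => hent j
    _ = (Fintype.card ι : ℝ) * p := by rw [Finset.sum_const, Finset.card_univ, nsmul_eq_mul]

omit [Fintype J] in
/-- ROW LETTER of the backward coefficient: `Σ_j|a⁻_μ(x)_{ij}| ≤ |ι|³·p` from `|S − 1| ≤ ηp` entrywise and `|R_{kl}| ≤ 1` (`η > 0`; crude). [folklore] -/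
theorem rowSum_curvCoefA_inr_le {η p : ℝ} (hη : 0 < η) (hR1 : ∀ μ x i j, |R μ x i j| ≤ 1) (hS : ∀ μ x i j, |(S μ x - 1) i j| ≤ η * p)
    (μ : J) (x : X) (i : ι) :
    ∑ j, |curvCoefA η τ R S (Sum.inr μ) x i j| ≤ (Fintype.card ι : ℝ) ^ 3 * p := by
  have hent : ∀ j, |curvCoefA η τ R S (Sum.inr μ) x i j| ≤ (Fintype.card ι : ℝ) ^ 2 * p := fun j => by
    rw [curvCoefA_inr, Matrix.smul_apply, smul_eq_mul, abs_mul, abs_of_pos (inv_pos.mpr hη)]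
    calc η⁻¹ * |conjDef τ R S μ x i j| ≤ η⁻¹ * ((Fintype.card ι : ℝ) ^ 2 * (η * p)) :=
          mul_le_mul_of_nonneg_left (abs_conjDef_entry_le τ R S hR1 hS μ x i j) (inv_pos.mpr hη).le
      _ = (Fintype.card ι : ℝ) ^ 2 * p := by field_simp
  calc ∑ j, |curvCoefA η τ R S (Sum.inr μ) x i j| ≤ ∑ _j : ι, (Fintype.card ι : ℝ) ^ 2 * p := Finset.sum_le_sum fun j _ => hent j
    _ = (Fintype.card ι : ℝ) ^ 3 * p := by rw [Finset.sum_const, Finset.card_univ, nsmul_eq_mul]; ring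

/-- ENTRY LETTER of the zeroth-order coefficient under the cancellation: for orthogonal `S`, `R`, `|S − 1| ≤ ηp` and `|S_μ − R₋ᵀS₋R₋| ≤ η²q` entrywise (`η > 0`):
`|c(x)_{ij}| ≤ |J|·(|ι|p² + q)` — the `η⁻²` is ABSORBED (second order in the field letter, first order in the covariant-gradient letter).
[cite: Balaban1985BackgroundPropagators, (3.37) p.396, (3.52) p.400 (shapes)] -/
theorem abs_curvCoefC_entry_le {η p q : ℝ} (hη : 0 < η) (hS : ∀ μ x, S μ x * (S μ x)ᵀ = 1) (hR : ∀ μ x, (R μ x)ᵀ * R μ x = 1)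
    (hSp : ∀ μ x i j, |(S μ x - 1) i j| ≤ η * p) (hSq : ∀ μ x i j, |covShiftDefect τ R S μ x i j| ≤ η ^ 2 * q) (x : X) (i j : ι) :
    |curvCoefC η τ R S x i j| ≤ (Fintype.card J : ℝ) * ((Fintype.card ι : ℝ) * p ^ 2 + q) := by
  have hη2 : 0 < η⁻¹ * η⁻¹ := mul_pos (inv_pos.mpr hη) (inv_pos.mpr hη)
  have hSp' : ∀ μ x i j, |(1 - S μ x : Matrix ι ι ℝ) i j| ≤ η * p := fun μ x i j => by
    have : (1 - S μ x : Matrix ι ι ℝ) i j = -((S μ x - 1) i j) := by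
      simp only [Matrix.sub_apply, neg_sub]
    rw [this, abs_neg]
    exact hSp μ x i j
  have hsq : ∀ μ, |((1 - S μ x) * (1 - S μ x)ᵀ : Matrix ι ι ℝ) i j| ≤ (Fintype.card ι : ℝ) * (η * p) ^ 2 := fun μ => by
    rw [Matrix.mul_apply]
    calc |∑ k, (1 - S μ x : Matrix ι ι ℝ) i k * (1 - S μ x : Matrix ι ι ℝ)ᵀ k j|
        ≤ ∑ k, |(1 - S μ x : Matrix ι ι ℝ) i k * (1 - S μ x : Matrix ι ι ℝ)ᵀ k j| := Finset.abs_sum_le_sum_abs _ _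
      _ ≤ ∑ _k : ι, (η * p) ^ 2 := Finset.sum_le_sum fun k _ => by
          rw [abs_mul, Matrix.transpose_apply, sq]
          exact mul_le_mul (hSp' μ x i k) (hSp' μ x j k) (abs_nonneg _) ((abs_nonneg _).trans (hSp' μ x i k))
      _ = (Fintype.card ι : ℝ) * (η * p) ^ 2 := by rw [Finset.sum_const, Finset.card_univ, nsmul_eq_mul]
  have hterm : ∀ μ, |((1 - S μ x) * (1 - S μ x)ᵀ + (covShiftDefect τ R S μ x)ᵀ : Matrix ι ι ℝ) i j| ≤
      (Fintype.card ι : ℝ) * (η * p) ^ 2 + η ^ 2 * q := fun μ => by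
    rw [Matrix.add_apply]
    refine (abs_add_le _ _).trans (add_le_add (hsq μ) ?_)
    rw [Matrix.transpose_apply]; exact hSq μ x j i
  rw [curvCoefC_eq_cancel τ R S η hS hR x, Matrix.neg_apply, abs_neg, Matrix.smul_apply, smul_eq_mul, abs_mul, abs_of_pos hη2, Matrix.sum_apply]
  calc η⁻¹ * η⁻¹ * |∑ μ, ((1 - S μ x) * (1 - S μ x)ᵀ + (covShiftDefect τ R S μ x)ᵀ : Matrix ι ι ℝ) i j|
      ≤ η⁻¹ * η⁻¹ * ∑ μ, |((1 - S μ x) * (1 - S μ x)ᵀ + (covShiftDefect τ R S μ x)ᵀ : Matrix ι ι ℝ) i j| :=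
        mul_le_mul_of_nonneg_left (Finset.abs_sum_le_sum_abs _ _) hη2.le
    _ ≤ η⁻¹ * η⁻¹ * ∑ _μ : J, ((Fintype.card ι : ℝ) * (η * p) ^ 2 + η ^ 2 * q) :=
        mul_le_mul_of_nonneg_left (Finset.sum_le_sum fun μ _ => hterm μ) hη2.le
    _ = (Fintype.card J : ℝ) * ((Fintype.card ι : ℝ) * p ^ 2 + q) := by
        rw [Finset.sum_const, Finset.card_univ, nsmul_eq_mul]
        field_simp

/-- ROW LETTER of the zeroth-order coefficient: `Σ_j|c(x)_{ij}| ≤ |ι|·|J|·(|ι|p² + q)` (orthogonal `S`, `R`; the two transporter letters entrywise; `η > 0`). [folklore] -/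
theorem rowSum_curvCoefC_le {η p q : ℝ} (hη : 0 < η) (hS : ∀ μ x, S μ x * (S μ x)ᵀ = 1) (hR : ∀ μ x, (R μ x)ᵀ * R μ x = 1)
    (hSp : ∀ μ x i j, |(S μ x - 1) i j| ≤ η * p) (hSq : ∀ μ x i j, |covShiftDefect τ R S μ x i j| ≤ η ^ 2 * q) (x : X) (i : ι) :
    ∑ j, |curvCoefC η τ R S x i j| ≤ (Fintype.card ι : ℝ) * ((Fintype.card J : ℝ) * ((Fintype.card ι : ℝ) * p ^ 2 + q)) := by
  calc ∑ j, |curvCoefC η τ R S x i j| ≤ ∑ _j : ι, (Fintype.card J : ℝ) * ((Fintype.card ι : ℝ) * p ^ 2 + q) :=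
        Finset.sum_le_sum fun j _ => abs_curvCoefC_entry_le τ R S hη hS hR hSp hSq x i j
    _ = _ := by rw [Finset.sum_const, Finset.card_univ, nsmul_eq_mul]

/-- **THE (3.42) PREFACTOR READING.**  At a cube of scale `ℓ = L^jη` the (3.37)-shaped letters read `p = α₁∕ℓ` (field: `|A′| < α₁(L^jη)^{−1}`) and `q = α₁∕ℓ²` (covariant
gradient: `|∇^η_U A′| < α₁(L^jη)^{−2}`); then `ℓ·rows(a⁺) ≤ |ι|α₁`, `ℓ·rows(a⁻) ≤ |ι|³α₁`, `ℓ²·rows(c) ≤ |ι||J|(|ι|α₁² + α₁)` — the first-order coefficients are absorbed by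
the prefactor `L^jη` of the derivative entries of (3.42), the zeroth-order one by the prefactor `(L^jη)²` of entry 0, with constants after `|J|, |ι|, α₁` ONLY (uniform in `η`,
the scale and the background `R`). [cite: Balaban1985BackgroundPropagators, (3.37) p.396, (3.42) p.397 (shapes)] -/
theorem rowSum_curv_pref {η ℓ α₁ : ℝ} (hη : 0 < η) (hℓ : 0 < ℓ) (hS : ∀ μ x, S μ x * (S μ x)ᵀ = 1) (hR : ∀ μ x, (R μ x)ᵀ * R μ x = 1)
    (hR' : ∀ μ x, R μ x * (R μ x)ᵀ = 1) (hSp : ∀ μ x i j, |(S μ x - 1) i j| ≤ η * (α₁ / ℓ))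
    (hSq : ∀ μ x i j, |covShiftDefect τ R S μ x i j| ≤ η ^ 2 * (α₁ / ℓ ^ 2)) (μ : J) (x : X) (i : ι) :
    ℓ * ∑ j, |curvCoefA η τ R S (Sum.inl μ) x i j| ≤ (Fintype.card ι : ℝ) * α₁ ∧
      ℓ * ∑ j, |curvCoefA η τ R S (Sum.inr μ) x i j| ≤ (Fintype.card ι : ℝ) ^ 3 * α₁ ∧
      ℓ ^ 2 * ∑ j, |curvCoefC η τ R S x i j| ≤ (Fintype.card ι : ℝ) * ((Fintype.card J : ℝ) * ((Fintype.card ι : ℝ) * α₁ ^ 2 + α₁)) := by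
  have hR1 : ∀ μ x i j, |R μ x i j| ≤ 1 := fun μ x i j => abs_entry_le_one_of_orthogonal (hR' μ x) i j
  refine ⟨?_, ?_, ?_⟩
  · calc ℓ * ∑ j, |curvCoefA η τ R S (Sum.inl μ) x i j| ≤ ℓ * ((Fintype.card ι : ℝ) * (α₁ / ℓ)) :=
          mul_le_mul_of_nonneg_left (rowSum_curvCoefA_inl_le τ R S hη hSp μ x i) hℓ.le
      _ = (Fintype.card ι : ℝ) * α₁ := by field_simp
  · calc ℓ * ∑ j, |curvCoefA η τ R S (Sum.inr μ) x i j| ≤ ℓ * ((Fintype.card ι : ℝ) ^ 3 * (α₁ / ℓ)) :=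
          mul_le_mul_of_nonneg_left (rowSum_curvCoefA_inr_le τ R S hη hR1 hSp μ x i) hℓ.le
      _ = (Fintype.card ι : ℝ) ^ 3 * α₁ := by field_simp
  · calc ℓ ^ 2 * ∑ j, |curvCoefC η τ R S x i j|
          ≤ ℓ ^ 2 * ((Fintype.card ι : ℝ) * ((Fintype.card J : ℝ) * ((Fintype.card ι : ℝ) * (α₁ / ℓ) ^ 2 + α₁ / ℓ ^ 2))) :=
          mul_le_mul_of_nonneg_left (rowSum_curvCoefC_le τ R S hη hS hR hSp hSq x i) (sq_nonneg ℓ)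
      _ = (Fintype.card ι : ℝ) * ((Fintype.card J : ℝ) * ((Fintype.card ι : ℝ) * α₁ ^ 2 + α₁)) := by field_simp

end Letters

end Summit.QuantumFields.YangMills.BalabanUVNodes.N15.CurvedSpecies

end
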